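import Mathlib
import HarnessLib
import Summits.HubbardSuperconductivity.HubbardSuperconductivity.Theorems.KLProgrammeKLRegimeEngineTowerLevLawFOfBlocksZX
import Summits.HubbardSuperconductivity.HubbardSuperconductivity.Theorems.KLProgrammeKLRegimeEngineTowerLevStepLinkUniformFKlEng

/-!
# Route `KLProgramme` — crux K3 ENGINE (stmt-HubbardSuperconductivity-20437 `KLRegimeEngineV17F2`), stub (b) v2, THE LEVELS PACKAGE (ℓ): THE FLOOR-KEYED LEVELLED
# LAW ON THE FLOW FRAME `K_n` WITH THE STEP DATA DISCHARGED, NO PARTITION-FUNCTION HYPOTHESIS, CHERNOFF DATA EXPORTED («(ℓ)-LAW-F-KLENG» on p4's `…_of_blocks_ZX`;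
# cell gate-hubbard-kl, seat hubbard-kl-k3c2-p3 g14; the Z/X-twin of this seat's `klTowerBLevF_le_law_lev_of_blocks_klEng` (…TowerLevLawFOfBlocksKlEng, p684766))

WHY.  p4's `klTowerBLevF_le_law_lev_of_blocks_ZX` (…TowerLevLawFOfBlocksZX, p687569) is the floor-keyed re-based levelled law with (i) NO per-block partition-function
hypothesis — `∀ k, 1 ≤ k ≤ Kb → Z^K_{Λ_{dk}} ≠ 0` is an OUTPUT (the Z-thread #17: `towerZ_succ_of_blockBounds` + Z-BASE) — and (ii) the Chernoff data and the five
smallness rows EXPORTED for the read-out (RO-4/RO-5).  Its per-block LINK data (Gram `κ_k`, decay `α_k`, analysis-overlap rows, under the four k-free bounds) are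
exactly the eight rows `linkDataF_klEng` delivers on the flow frame `K_n := klFlowFrameU L M β U μ n` under the v1 doors and an admissible history.  This file is
the composition — the statement of `klTowerBLevF_le_law_lev_of_blocks_klEng` with the `hZl` binder DELETED, the `X′` row over `2 ≤ k ≤ Kb`, and the conclusion of
`…_of_blocks_ZX` (Z-invariant ∧ law ∧ Chernoff data ∧ smallness rows) at `K := K_n`:

* **`klTowerBLevF_le_law_lev_of_blocks_ZX_klEng`**.
What REMAINS as hypotheses: p3's weighted grid-step rows at `(Λ_d, F_{d−1})` on `K_n` (base), E1's imports `ι₂ X` and cell datum, the per-block degree cap, the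
numerics block at `(A′, Q′)` and the two tiny doors — verbatim from p4's statement.  Compositions of landed theorems; nothing about the model is asserted beyond them;
nothing asserts (ℓ), any stub, K3 or superconductivity.  References: BGM 2006 §2.8 (2.76)–(2.84), (2.93)–(2.98), §3 (3.2)–(3.8) [cite: BenfattoGiulianiMastropietro2006].
-/

noncomputable section

namespace Summit.HubbardSuperconductivity.HubbardSuperconductivity.Theorems.EngineV8

set_option linter.dupNamespace false -- summit = problem name (single-conjunct summit), D-0017

open Classical
open Real Finset Literature.MathematicalPhysics.QuantumLattice Literature.Probability.LatticeModels GrassmannAlgebra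
open Literature.Probability.LatticeModels.BattleFederbush
open Literature.MathematicalPhysics.QuantumLattice.FermiRG
open Summit.HubbardSuperconductivity.HubbardSuperconductivity.Theorems.KLProgrammeLegKernels
open Summit.HubbardSuperconductivity.HubbardSuperconductivity.Theorems.KLRegimeSplit
open Summit.HubbardSuperconductivity.HubbardSuperconductivity.Theorems.KLRegimeWick
open Summit.HubbardSuperconductivity.HubbardSuperconductivity.Theorems.TorusFourierL2
open Summit.HubbardSuperconductivity.HubbardSuperconductivity.Theorems.DispersionFlow

/-- **THE FLOOR-KEYED LEVELLED LAW ON THE FLOW FRAME, STEP DATA FROM THE MODEL, NO PARTITION-FUNCTION HYPOTHESIS, CHERNOFF DATA EXPORTED** («(ℓ)-LAW-F-KLENG» on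
`…_of_blocks_ZX`; see the module docstring for the binder list and what is discharged). [cite: BenfattoGiulianiMastropietro2006, §2.8 (2.76)-(2.84), (2.93)-(2.98), §3 (3.2)-(3.8)] -/
theorem klTowerBLevF_le_law_lev_of_blocks_ZX_klEng (d : ℕ) (c'' : ℝ) (hc'' : 0 < c'') :
    ∃ C₁ C₂ : ℝ, 0 < C₁ ∧ 0 < C₂ ∧ ∀ R : RenConsts, R.WF2 → ∃ c₃' : ℝ, 0 < c₃' ∧ ∃ U₀' : ℝ, 0 < U₀' ∧
      ∃ Cκ Cb CJ : ℝ, 0 < Cκ ∧ 0 < Cb ∧ 0 < CJ ∧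
      ∀ (G : GeoConsts) (P : SplitConsts) (Q : EngConsts) (c : ℝ), P.WF → 0 < c → c ≤ klEngC₃6 P R → c ≤ c₃' →
      ∀ μ ∈ klWindowC, ∀ U : ℝ, 0 < U → U ≤ klEngU₀9 P R c → U ≤ U₀' → c'' * U ≤ 1 → ∀ β : ℝ, klBetaMin ≤ β → β ≤ Real.exp (c / U ^ 2) →
      ∀ (L M : ℕ) [NeZero L] [NeZero M], klEngL₃ β U ≤ L → klEngM₃ β U L ≤ M →
      ∀ n : ℕ, 1 ≤ n → n ≤ nScales β + 1 → IsKLRegime U c (-(n : ℤ)) →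
        HistP klPredsV17F2 L M G P Q R β U μ 0 n → FrameOK R U (nScales β) μ (klFlowFrameU L M β U μ n) →
        (∀ m, 1 ≤ m → m < n → FlowPieceOscAt L M c'' β U μ m) →
      2 ≤ d → ∀ Kb D : ℕ, d * Kb ≤ nScales β + 1 → d * Kb ≤ n + d → 3 ≤ D →
      ∀ (cc : ℝ) (n' j : ℕ), IsKLRegime U cc (-(n' : ℤ)) → j ≤ n' →
      ∀ (B : ℝ), 1 ≤ B →
      -- p3's weighted grid step hypotheses at the cutoff `Λ_d`, analysis family `F_{d−1}`, rate `jw`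
      ∀ (jw : ℕ) (κ : ℝ), 0 < κ →
        IsGramBoundedR ((hubbardGridSub L M β (2 * (2 * M))).transpose * hubbardCovAboveCT L M β μ 0 (klFlowFrameU L M β U μ n) (klScale klE0 d) *
          hubbardGridSub L M β (2 * (2 * M))) κ →
      ∀ (αw : ℝ), 0 < αw →
        (∀ X, ∑ Y, ‖((hubbardGridSub L M β (2 * (2 * M))).transpose * hubbardCovAboveCT L M β μ 0 (klFlowFrameU L M β U μ n) (klScale klE0 d) *
          hubbardGridSub L M β (2 * (2 * M))) X Y‖ * gridLabelWt L (2 * (2 * M)) β {gridLegPos X, gridLegPos Y} ≤ αw) →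
        (∀ Y, ∑ X, ‖((hubbardGridSub L M β (2 * (2 * M))).transpose * hubbardCovAboveCT L M β μ 0 (klFlowFrameU L M β U μ n) (klScale klE0 d) *
          hubbardGridSub L M β (2 * (2 * M))) X Y‖ * gridLabelWt L (2 * (2 * M)) β {gridLegPos X, gridLegPos Y} ≤ αw) →
      ∀ (ρ : ℝ), 0 < ρ →
        Real.exp 1 * αw * normV (GridLeg (GridPoint L (2 * (2 * M)))) κ ρ
          (fun m' : ℕ => if m' = 1 then |β| / (2 * (2 * M) : ℕ) * ∑ z : TorusSite 2 L, ‖framePosKernel L (klFlowFrameU L M β U μ n) z‖ * (1 + torusSiteDist z 0)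
            else if m' = 2 then |U| * |β| / (2 * (2 * M) : ℕ) else 0) / κ ^ 2 < 1 →
      ∀ (crw ccw : ℝ), 0 < crw → 0 < ccw →
        (∀ X'' : SpaceTimeIdx L M × SectorLeg (sectorCount (d - 1)), ∑ X' : GridLeg (GridPoint L (2 * (2 * M))),
          ‖(sectorAnalysisMatrix L M β (klAnisoFamily L M β μ (klFlowFrameU L M β U μ n) klE0 (d - 1)) * hubbardGridSub L M β (2 * (2 * M))) X'' X'‖ *
            gridLabelWt L (2 * (2 * M)) β {latticeLegPos (2 * (2 * M)) X'', gridLegPos X'} ≤ crw) →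
        (∀ X' : GridLeg (GridPoint L (2 * (2 * M))), ∑ X'' : SpaceTimeIdx L M × SectorLeg (sectorCount (d - 1)),
          ‖(sectorAnalysisMatrix L M β (klAnisoFamily L M β μ (klFlowFrameU L M β U μ n) klE0 (d - 1)) * hubbardGridSub L M β (2 * (2 * M))) X'' X'‖ *
            gridLabelWt L (2 * (2 * M)) β {latticeLegPos (2 * (2 * M)) X'', gridLegPos X'} ≤ ccw) →
      -- the derived base constants (equational binders)
      ∀ (nV cF cg Ag Pg : ℝ),
        nV = normV (GridLeg (GridPoint L (2 * (2 * M)))) κ ρ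
          (fun m' : ℕ => if m' = 1 then |β| / (2 * (2 * M) : ℕ) * ∑ z : TorusSite 2 L, ‖framePosKernel L (klFlowFrameU L M β U μ n) z‖ * (1 + torusSiteDist z 0)
            else if m' = 2 then |U| * |β| / (2 * (2 * M) : ℕ) else 0) →
        cF = (Real.exp 2 * (κ + ρ)) ^ (2 * 2) * (|β| / (2 * (2 * M) : ℕ)) → cg = Real.exp 1 * αw * cF / κ ^ 2 →
        Ag = crw * Real.exp 1 * cF / (ccw * cg ^ 2) → Pg = ccw ^ 2 * cg / (ρ ^ 2 * (1 - Real.exp 1 * αw * nV / κ ^ 2)) →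
      ∀ (ι₂ X : ℝ), 0 ≤ ι₂ → 0 ≤ X →
      ∀ (Ab Qb Ab' ι₂' X' : ℝ), Ab = (2 : ℝ) ^ (7 * (d - 1)) * Ag / P.Klam ^ 2 → Qb = Pg / (8 : ℝ) ^ (d - 1) →
        Ab' = Ab / B ^ 2 → ι₂' = ι₂ / B → X' = X / B ^ 2 →
      -- the floor LINK data: per-block degree cap (the Gram, decay and overlap rows are DISCHARGED; the four k-free constants are pinned; NO partition function)
      ∀ (κb αb crb ccb : ℝ), κb = Real.sqrt (2 * Cκ * klE0) → αb = Cb * ((M : ℝ) / β) * (4 : ℝ) ^ d / klE0 →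
        crb = 81 * CJ * M / β → ccb = 162 * CJ * M / β →
      (∀ k, 1 ≤ k → k < Kb → Fintype.card (SpaceTimeIdx L M × SectorLeg (sectorCount (d * k - 1))) / 2 ≤ D) →
      -- the law's six names PINNED by the link (equational binders), and the import `ι₁`
      ∀ (W Z σ Φ ψ τ ι₁ : ℝ), W = 64 * (27 : ℝ) ^ 4 * exp 2 * crb / ccb → Z = exp 4 * ccb ^ 2 * imagTimeWeight β M ^ 2 / 8 →
        σ = κb ^ 2 / (exp 4 * ccb ^ 2) → Φ = 9 * αb * ccb / ((27 : ℝ) ^ 5 * exp 1 * κb ^ 2 * crb) → ψ = exp 4 * ccb ^ 2 / κb ^ 2 →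
        τ = exp 2 * κb ^ 2 / ccb ^ 2 → 0 ≤ ι₁ →
      ∀ (ρk Q' Q κA Yb Y A A' ι₃ : ℝ), ρk = max 4 (2 * τ * ψ) → Q' = Z * Qb + 1 → Q = ρk * Q' →
        κA = W * ((27 : ℝ) ^ 5 * (C₁ / C₂) * (8 : ℝ) ^ (d - 1)) →
        Yb = ι₂ / (2 * Q') + W * Z ^ 3 * X / (4 * Q' ^ 2) + (W * (27 : ℝ) ^ 5 * Ab + κA * Ab) * Q' / 2 →
        Y = ι₂' / (2 * Q') + W * Z ^ 3 * X' / (4 * Q' ^ 2) + (W * (27 : ℝ) ^ 5 * Ab' + κA * Ab') * Q' / 2 →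
        A = 2 * Y * (1 - ((2 : ℝ) ^ d)⁻¹) / (κA * Q') →
        A' = (W * (27 : ℝ) ^ 5 * Ab' + κA * Ab') + 2 * Y / Q' → ι₃ = W * Z ^ 3 * X' + A' * Q' ^ 3 →
      max 1 Z * C₂ ^ 2 * max 4 (2 * τ * ψ) ≤ (2 : ℝ) ^ (d - 1) →
      max 1 (max (8 * Φ * τ * Yb) (128 * exp 1 * ψ ^ 3 * τ ^ 4 * Φ * κA * Yb / ((1 - ((2 : ℝ) ^ d)⁻¹) * ρk ^ 3))) ≤ B →
      (∀ k, 1 ≤ k → k < Kb → W * Z ^ 1 * klTowerMuLevF L M β U μ (klFlowFrameU L M β U μ n) d k 1 ≤ ι₁ * (B * epsCoupling P U j)) →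
      (∀ k, 1 ≤ k → k < Kb → W * Z ^ 2 * klTowerMuLevF L M β U μ (klFlowFrameU L M β U μ n) d k 2 ≤ ι₂' * (B * epsCoupling P U j)) →
      (∀ k, 2 ≤ k → k ≤ Kb → klTowerMuLevAtF L M β U μ (klFlowFrameU L M β U μ n) d 0 k 3 ≤ X' * (B * epsCoupling P U j) ^ 2) →
      U ≤ min 1 (min (1 / (8 * σ * Q' + 1)) (min (1 / (2 * exp 1 * τ * Q' + 1)) (min (1 / (4 * Φ * τ * ι₁ + 1))
        (min (1 / (2 * (Φ * (exp 1 * τ * ι₁ + (exp 1 * τ) ^ 2 * ι₂' + (exp 1 * τ) ^ 3 * ι₃ + A' * (exp 1 * τ * Q') ^ 2 / 2)) + 1))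
          (min (A * Q ^ 3 / (16 * σ * Q' * A' * (4 * Q') ^ 3 + A * Q ^ 3))
            (A * Q ^ 3 / (16 * exp 1 * ψ * (2 * τ * ψ * Q') ^ 2 * Φ * τ ^ 2 * ι₁ ^ 2 + A * Q ^ 3))))))) / (2 * B * P.Klam + 1) →
      cc ≤ min 1 (min (1 / (8 * σ * Q' + 1)) (min (1 / (2 * exp 1 * τ * Q' + 1)) (min (1 / (4 * Φ * τ * ι₁ + 1))
        (min (1 / (2 * (Φ * (exp 1 * τ * ι₁ + (exp 1 * τ) ^ 2 * ι₂' + (exp 1 * τ) ^ 3 * ι₃ + A' * (exp 1 * τ * Q') ^ 2 / 2)) + 1))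
          (min (A * Q ^ 3 / (16 * σ * Q' * A' * (4 * Q') ^ 3 + A * Q ^ 3))
            (A * Q ^ 3 / (16 * exp 1 * ψ * (2 * τ * ψ * Q') ^ 2 * Φ * τ ^ 2 * ι₁ ^ 2 + A * Q ^ 3))))))) * Real.log 4 / (2 * B * P.Klam + 1) →
      (∀ k, 1 ≤ k → k ≤ Kb → hubbardEffPartitionFnCT L M β U μ 0 (klFlowFrameU L M β U μ n) (klScale klE0 (d * k)) ≠ 0) ∧
      (∀ k, 2 ≤ k → k ≤ Kb → ∀ (t : Fin 5) (p : ℕ), 3 ≤ p → p ≤ D →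
        klTowerBLevF L M β U μ (klFlowFrameU L M β U μ n) d t k p ≤ A * (B * epsCoupling P U j) ^ (p - 1) * Q ^ p) ∧
      (∀ k, 1 ≤ k → k ≤ Kb →
        (∀ m, 4 ≤ m → m ≤ D → W * Z ^ m * klTowerMuLevF L M β U μ (klFlowFrameU L M β U μ n) d k m ≤ A' * (B * epsCoupling P U j) ^ (m - 1) * Q' ^ m) ∧
        (3 ≤ D → W * Z ^ 3 * klTowerMuLevF L M β U μ (klFlowFrameU L M β U μ n) d k 3 ≤ ι₃ * (B * epsCoupling P U j) ^ 2)) ∧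
      (4 * σ * (B * epsCoupling P U j) * Q' < 1 ∧ 2 * (B * epsCoupling P U j) * τ * Q' ≤ 1 ∧ exp 1 * τ * (B * epsCoupling P U j) * Q' < 1 ∧
        Φ * (τ * (ι₁ * (B * epsCoupling P U j) + ι₂' / (2 * Q') + ι₃ / (4 * Q' ^ 2) + A' * Q' / 4)) < 1 ∧
        Φ * (exp 1 * τ * (ι₁ * (B * epsCoupling P U j)) + (exp 1 * τ) ^ 2 * (ι₂' * (B * epsCoupling P U j)) + (exp 1 * τ) ^ 3 * (ι₃ * (B * epsCoupling P U j) ^ 2) +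
          A' * (exp 1 * τ * Q') * ((exp 1 * τ * (B * epsCoupling P U j) * Q') ^ 3 / (1 - exp 1 * τ * (B * epsCoupling P U j) * Q'))) < 1) := by
  obtain ⟨C₁, C₂, hC₁, hC₂, h⟩ := klTowerBLevF_le_law_lev_of_blocks_ZX
  refine ⟨C₁, C₂, hC₁, hC₂, fun R hR2 => ?_⟩
  obtain ⟨c₃, hc₃, U₀, hU₀, h'⟩ := h R hR2
  obtain ⟨Cκ, Cb, CJ, hCκ, hCb, hCJ, hdata⟩ := linkDataF_klEng d R c'' hc''
  refine ⟨c₃, hc₃, U₀, hU₀, Cκ, Cb, CJ, hCκ, hCb, hCJ, ?_⟩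
  intro G P Qe c hP hc hc6 hc₃' μ hμ U hU hU9 hU₀' hcU β hβmin hβc L M _ _ hL3 hM3 n hn1 hnN hreg hhist hfr hosc hd Kb D hKbN hKbn hD cc n' j hreg' hj
    B hB jw κ hκ hGB αw hαw hrow hcol ρ hρ hθ crw ccw hcrw hccw hrow' hcol' nV cF cg Ag Pg hnV hcF hcg hAg hPg ι₂ X hι₂ hX Ab Qb Ab' ι₂' X' hAb hQb
    hAb' hι₂' hX' κb αb crb ccb hκb hαb hcrb hccb hDl W Z σ Φ ψ τ ι₁ hW hZ hσ hΦ hψ hτ hι₁ ρk Q' Q κA Yb Y A A' ι₃ hρk hQ' hQ hκA hYb hY hA hA' hι₃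
    hblock hBle himp₁ himp₂ hcell hUdoor hcdoor
  have he : (0 : ℝ) < klE0 := by norm_num [klE0]
  have hβ : 0 < β := KLRegimeSplit.pos_of_klBetaMin_le hβmin
  have hM0 : (0 : ℝ) < M := Nat.cast_pos.2 (Nat.pos_of_ne_zero (NeZero.ne M))
  have hκb0 : 0 < κb := by rw [hκb]; exact Real.sqrt_pos.2 (by positivity)
  have hαb0 : 0 < αb := by rw [hαb]; positivity
  have hcrb0 : 0 < crb := by rw [hcrb]; positivity
  have hccb0 : 0 < ccb := by rw [hccb]; positivity
  have hKbN' : d * Kb - 1 ≤ nScales β + 1 := by omega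
  -- the per-block data from the model
  have hD' : ∀ k, 1 ≤ k → k < Kb →
      0 < Real.sqrt (Cκ * (klScale klE0 (d * k) / klScale klE0 (d * k - 1)) * (klE0 * ((8 : ℝ) ^ (d * k - 1))⁻¹)) ∧
      Real.sqrt (Cκ * (klScale klE0 (d * k) / klScale klE0 (d * k - 1)) * (klE0 * ((8 : ℝ) ^ (d * k - 1))⁻¹)) ^ 2 * (8 : ℝ) ^ (d * k) ≤ Real.sqrt (2 * Cκ * klE0) ^ 2 ∧
      IsGramBoundedR ((sectorSubMatrix L M β (bgmFatMultiplier L M klE0 β (nambuXiCT L μ (klFlowFrameU L M β U μ n)) (d * k - 1))).transpose *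
        hubbardCovSliceCT L M β μ 0 (klFlowFrameU L M β U μ n) (klScale klE0 (d * (k + 1))) (klScale klE0 (d * k)) *
        sectorSubMatrix L M β (bgmFatMultiplier L M klE0 β (nambuXiCT L μ (klFlowFrameU L M β U μ n)) (d * k - 1))) (Real.sqrt (Cκ * (klScale klE0 (d * k) / klScale klE0 (d * k - 1)) * (klE0 * ((8 : ℝ) ^ (d * k - 1))⁻¹))) ∧
      (∀ X, ∑ Y, ‖((sectorSubMatrix L M β (bgmFatMultiplier L M klE0 β (nambuXiCT L μ (klFlowFrameU L M β U μ n)) (d * k - 1))).transpose *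
        hubbardCovSliceCT L M β μ 0 (klFlowFrameU L M β U μ n) (klScale klE0 (d * (k + 1))) (klScale klE0 (d * k)) *
        sectorSubMatrix L M β (bgmFatMultiplier L M klE0 β (nambuXiCT L μ (klFlowFrameU L M β U μ n)) (d * k - 1))) X Y‖ ≤ Cb * ((M : ℝ) / β) / klScale klE0 (d * (k + 1))) ∧
      (∀ Y, ∑ X, ‖((sectorSubMatrix L M β (bgmFatMultiplier L M klE0 β (nambuXiCT L μ (klFlowFrameU L M β U μ n)) (d * k - 1))).transpose *
        hubbardCovSliceCT L M β μ 0 (klFlowFrameU L M β U μ n) (klScale klE0 (d * (k + 1))) (klScale klE0 (d * k)) *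
        sectorSubMatrix L M β (bgmFatMultiplier L M klE0 β (nambuXiCT L μ (klFlowFrameU L M β U μ n)) (d * k - 1))) X Y‖ ≤ Cb * ((M : ℝ) / β) / klScale klE0 (d * (k + 1))) ∧
      Cb * ((M : ℝ) / β) / klScale klE0 (d * (k + 1)) ≤ Cb * ((M : ℝ) / β) * (4 : ℝ) ^ d / klE0 * (4 : ℝ) ^ (d * k) ∧
      (∀ X'', ∑ X', ‖(sectorAnalysisMatrix L M β (klAnisoFamily L M β μ (klFlowFrameU L M β U μ n) klE0 (d * k)) *
        sectorSubMatrix L M β (bgmFatMultiplier L M klE0 β (nambuXiCT L μ (klFlowFrameU L M β U μ n)) (d * k - 1))) X'' X'‖ ≤ 81 * CJ * M / β) ∧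
      (∀ X', ∑ X'', ‖(sectorAnalysisMatrix L M β (klAnisoFamily L M β μ (klFlowFrameU L M β U μ n) klE0 (d * k)) *
        sectorSubMatrix L M β (bgmFatMultiplier L M klE0 β (nambuXiCT L μ (klFlowFrameU L M β U μ n)) (d * k - 1))) X'' X'‖ ≤ 162 * CJ * M / β) := by
    intro k hk1 hk
    have hdk : 2 ≤ d * k := le_trans hd (Nat.le_mul_of_pos_right d hk1)
    have hkN : d * (k + 1) ≤ nScales β + 1 := le_trans (Nat.mul_le_mul_left d (by omega)) hKbN
    have h1 : d * k + d ≤ d * Kb := by rw [← Nat.mul_succ]; exact Nat.mul_le_mul_left d (by omega)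
    exact hdata G P Qe c hP hR2 hc hc6 μ hμ U hU hU9 hcU β hβmin hβc L M hL3 hM3 n hn1 hnN hreg hhist hfr hosc k hk1 hdk hkN (by omega)
  exact h' P c hP hc hc6 hc₃' μ hμ U hU hU9 hU₀' β hβmin hβc (klFlowFrameU L M β U μ n) hfr L M hL3 hM3 d Kb D hd hKbN' hD cc n' j hreg' hj B hB
    jw κ hκ hGB αw hαw hrow hcol ρ hρ hθ crw ccw hcrw hccw hrow' hcol' nV cF cg Ag Pg hnV hcF hcg hAg hPg ι₂ X hι₂ hX Ab Qb Ab' ι₂' X' hAb hQb hAb'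
    hι₂' hX' κb αb crb ccb hκb0 hαb0 hcrb0 hccb0
    (fun k => Real.sqrt (Cκ * (klScale klE0 (d * k) / klScale klE0 (d * k - 1)) * (klE0 * ((8 : ℝ) ^ (d * k - 1))⁻¹))) (fun k => Cb * ((M : ℝ) / β) / klScale klE0 (d * (k + 1)))
    (fun k hk1 hk => (hD' k hk1 hk).1) (fun k hk1 hk => by rw [hκb]; exact (hD' k hk1 hk).2.1)
    (fun k hk1 hk => by rw [hαb]; exact (hD' k hk1 hk).2.2.2.2.2.1) (fun k hk1 hk => (hD' k hk1 hk).2.2.1)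
    (fun k hk1 hk => (hD' k hk1 hk).2.2.2.1) (fun k hk1 hk => (hD' k hk1 hk).2.2.2.2.1)
    (fun k hk1 hk => by rw [hcrb]; exact (hD' k hk1 hk).2.2.2.2.2.2.1) (fun k hk1 hk => by rw [hccb]; exact (hD' k hk1 hk).2.2.2.2.2.2.2)
    hDl W Z σ Φ ψ τ ι₁ hW hZ hσ hΦ hψ hτ hι₁ ρk Q' Q κA Yb Y A A' ι₃ hρk hQ' hQ hκA hYb hY hA hA' hι₃ hblock hBle himp₁ himp₂ hcell hUdoor hcdoor

end Summit.HubbardSuperconductivity.HubbardSuperconductivity.Theorems.EngineV8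

end
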